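import Mathlib

/-!
# Route RisoStrata — crux `RisoGlobalisation` (stmt-ResolutionOfSingularities-18547)

Leaf `stub_stepEqChart` of line SketchIdeator1.

`B := k[h_i/h_j] ⊆ K` is the `j`-th standard affine chart of the projective model of a vector
`h ∈ (Kˣ)^{N+1}`; the crux blows it up along an ideal `I ⊆ B` by passing to
`step B x := k[B ∪ I·x⁻¹]` for a denominator `x ∈ I`.  When `I` is spanned by the dehomogenised
forms `G_l/h_j^E` and `x = G_μ/h_j^E`, this is literally the standard chart `(j, μ)` of the
projective model of the vector of products `(h_i G_l)_{(i,l)}`, namely `k[h_iG_l/(h_jG_μ)]`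
(Zariski–Samuel, vol. II, ch. VI §17: a monoidal transform is the projective model of the
products).

Proof: two `Algebra.adjoin_le`.
* (⊇) `h_iG_l/(h_jG_μ) = (h_i/h_j) · (G_l/h_j^E) · (G_μ/h_j^E)⁻¹`, the product of an element
  of `B` and a generator `a·x⁻¹` with `a = G_l/h_j^E ∈ I`.
* (⊆) `B ≤ RHS` since `h_i/h_j = h_iG_μ/(h_jG_μ)` (index `(i, μ)`); and for `a ∈ I` a span
  induction reduces `a · x⁻¹ ∈ RHS` to the generators, where
  `(G_l/h_j^E) · (G_μ/h_j^E)⁻¹ = (h_jG_l)/(h_jG_μ)` (index `(j, l)`).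
-/

-- single-problem summit: the doubled namespace component `ResolutionOfSingularities` is forced
set_option linter.dupNamespace false

namespace Summit.ResolutionOfSingularities.ResolutionOfSingularities.Theorems

variable {k K : Type} [Field k] [Field K] [Algebra k K]

/-- **The blow-up chart is a standard chart of the product vector.**  For `h ∈ (Kˣ)^{N+1}`,
`B = k[h_i/h_j]`, forms `G_l` with `G_l/h_j^E ∈ B` and `G_μ ≠ 0`, the ring
`k[B ∪ I·(G_μ/h_j^E)⁻¹]` (`I` the ideal of `B` spanned by the `G_l/h_j^E`) equals the chart
`k[h_iG_l/(h_jG_μ)]` of the vector of products `(h_iG_l)_{(i,l)}`. -/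
theorem stub_stepEqChart {N M : ℕ} (h : Fin (N + 1) → K) (hh : ∀ i, h i ≠ 0) (j : Fin (N + 1))
    (G : Fin (M + 1) → K) (E : ℕ) (μ : Fin (M + 1)) (hμ : G μ ≠ 0)
    (hG : ∀ l, G l * (h j ^ E)⁻¹ ∈ Algebra.adjoin k (Set.range fun i => h i * (h j)⁻¹)) :
    Algebra.adjoin k ((Algebra.adjoin k (Set.range fun i => h i * (h j)⁻¹) : Set K) ∪
        {y | ∃ a ∈ Ideal.span (Set.range fun l =>
          (⟨G l * (h j ^ E)⁻¹, hG l⟩ : ↥(Algebra.adjoin k (Set.range fun i => h i * (h j)⁻¹)))),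
          y = (a : K) * (G μ * (h j ^ E)⁻¹)⁻¹}) =
      Algebra.adjoin k (Set.range fun il : Fin (N + 1) × Fin (M + 1) =>
        (h il.1 * G il.2) * (h j * G μ)⁻¹) := by
  have hj : h j ≠ 0 := hh j
  set B : Subalgebra k K := Algebra.adjoin k (Set.range fun i => h i * (h j)⁻¹)
  set R : Subalgebra k K := Algebra.adjoin k (Set.range fun il : Fin (N + 1) × Fin (M + 1) =>
    (h il.1 * G il.2) * (h j * G μ)⁻¹)
  -- the old chart is contained in the new one: `h_i/h_j = h_iG_μ/(h_jG_μ)`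
  have hBR : B ≤ R := by
    refine Algebra.adjoin_le ?_
    rintro _ ⟨i, rfl⟩
    have e : h i * (h j)⁻¹ = (h i * G μ) * (h j * G μ)⁻¹ := by
      field_simp
    show h i * (h j)⁻¹ ∈ R
    rw [e]
    exact Algebra.subset_adjoin ⟨(i, μ), rfl⟩
  apply le_antisymm
  · refine Algebra.adjoin_le ?_
    rintro y (hy | ⟨a, ha, rfl⟩)
    · exact hBR hy
    · induction ha using Submodule.span_induction with
      | mem a ha =>
        obtain ⟨l, rfl⟩ := ha
        have e : (G l * (h j ^ E)⁻¹) * (G μ * (h j ^ E)⁻¹)⁻¹ = (h j * G l) * (h j * G μ)⁻¹ := by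
          field_simp
        show (G l * (h j ^ E)⁻¹) * (G μ * (h j ^ E)⁻¹)⁻¹ ∈ R
        rw [e]
        exact Algebra.subset_adjoin ⟨(j, l), rfl⟩
      | zero =>
        rw [ZeroMemClass.coe_zero, zero_mul]
        exact zero_mem _
      | add a b _ _ ha hb =>
        rw [AddMemClass.coe_add, add_mul]
        exact add_mem ha hb
      | smul r a _ ha =>
        rw [smul_eq_mul, MulMemClass.coe_mul, mul_assoc]
        exact mul_mem (hBR r.2) ha
  · refine Algebra.adjoin_le ?_
    rintro _ ⟨⟨i, l⟩, rfl⟩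
    have e : (h i * G l) * (h j * G μ)⁻¹ =
        (h i * (h j)⁻¹) * ((G l * (h j ^ E)⁻¹) * (G μ * (h j ^ E)⁻¹)⁻¹) := by
      field_simp
    show (h i * G l) * (h j * G μ)⁻¹ ∈ _
    rw [e]
    exact mul_mem (Algebra.subset_adjoin (Set.mem_union_left _ (Algebra.subset_adjoin ⟨i, rfl⟩)))
      (Algebra.subset_adjoin (Set.mem_union_right _
        ⟨⟨G l * (h j ^ E)⁻¹, hG l⟩, Ideal.subset_span ⟨l, rfl⟩, rfl⟩))

end Summit.ResolutionOfSingularities.ResolutionOfSingularities.Theorems
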